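import Summits.Ventures.PercRepro.C025ProfilePLDResPlaneTwelveA
import Summits.Ventures.PercRepro.C025ProfilePLDResPlaneTwelveB
import Summits.Ventures.PercRepro.C025ProfilePLDResPlaneTwelveC
import Summits.Ventures.PercRepro.C025ProfilePLDResPlaneTwelveD
import Summits.Ventures.PercRepro.C025ProfilePLDResPlaneTwelveE
import Summits.Ventures.PercRepro.C025ProfilePLDResPlaneTwelveF
import Summits.Ventures.PercRepro.C025ProfilePLDResPlaneTwelveG
import Summits.Ventures.PercRepro.C025ProfilePLDResPlaneTwelveH
import Summits.Ventures.PercRepro.C025ProfilePLDResPlaneTwelveI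
import Summits.Ventures.PercRepro.C025ProfilePLDResPlaneTwelveJ
import Summits.Ventures.PercRepro.C025ProfilePLDResPlaneTwelveK
import Summits.Ventures.PercRepro.C025ProfilePLDResPlaneTwelveL
import Summits.Ventures.PercRepro.C025ProfilePLDResPlaneTwelveM
import Summits.Ventures.PercRepro.C025ProfilePLDResPlaneTwelveN
import Summits.Ventures.PercRepro.C025ProfilePLDResPlaneTwelveO
import Summits.Ventures.PercRepro.C025ProfilePLDResPlaneTwelveP
import Summits.Ventures.PercRepro.C025ProfilePLDResidualCertificate
import Summits.Ventures.PercRepro.C025ProfilePLDTwoFlat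

/-!
# PER-LAYER DOMINANCE FOR «M ⊕ U_{3,5}» FROM THE RESIDUAL INEQUALITIES OF `M`, RANK ≤ 12: THE SECOND TOWER (night-3 g36)

`proofs/NIGHT3-G36-CEILING.md` §3.  `pld_disjointSum_uniform_3_5_of_res_eRank_le_12`: if a finite matroid `M` of rank ≤ 12 satisfies the RESIDUAL inequalities
`#RS ≤ #THI` at every `(lo, hi, δ)` (the form of per-layer dominance the cell's injections prove — paving matroids:
`PLDResCert.res_of_paving`; it implies (PLD)), then `M ⊕ U_{3,5}` satisfies (PLD) at every admissible `(lo, hi, δ, Θ)` — the binder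
of `PLDBridge.rls_disjointSum_freeOn_of_pld`, so C-025 holds at every `(p, q)` on every truncation of `M ⊕ U_{3,5} ⊕ free points`.
The (PLD)-instance certificates of the lift tower cannot do this beyond rank 6 for `U_{2,3}` (the base map: `U_{2,3}` is not
certifiable at rank 7, `C025ProfilePLDLineFarkasSeven`); the residual instances of `M` certify it at every rank probed (≤ 20),
here at rank ≤ 12 through the table `res_uniform_3_5_table_12_part*` (16 parts, `decide`) and the residual certificate
lemma `PLDResCert.sum_le_of_cert_res`.  The uniform matroid is `truncate (freeOn F) 3` with `|F| = 5`.
No `def`, no `instance`, no notation.  Axioms: standard.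
-/

open scoped Matroid

namespace PercRepro

open Finset ThmH

namespace PLDResLift

variable {α : Type} [DecidableEq α]

set_option maxRecDepth 16384 in
/-- (PLD) FOR «M ⊕ U_{3,5}» FOR EVERY MATROID `M` OF RANK ≤ 12 SATISFYING THE RESIDUAL INEQUALITIES. -/
theorem pld_disjointSum_uniform_3_5_of_res_eRank_le_12 (M : Matroid α) [M.Finite] (hr : M.eRank ≤ 12)
    (hRES : ∀ lo hi δ : ℕ,
      (∑ I ∈ (gr M).powerset, (if lo ≤ (M.eRk (I : Set α)).toNat ∧ (M.eRk (I : Set α)).toNat ≤ hi ∧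
          hi + δ + 1 ≤ (M.eRk ((gr M \ I : Finset α) : Set α)).toNat then
          ((M.eRk ((gr M \ I : Finset α) : Set α)).toNat).choose δ else 0)) ≤
        ∑ I ∈ (gr M).powerset, (if lo + δ ≤ (M.eRk ((gr M \ I : Finset α) : Set α)).toNat ∧
          (M.eRk ((gr M \ I : Finset α) : Set α)).toNat ≤ hi + δ ∧ hi + 1 ≤ (M.eRk (I : Set α)).toNat then
          ((M.eRk ((gr M \ I : Finset α) : Set α)).toNat).choose δ else 0))
    (F : Finset α) (hF : F.card = 5)
    (h : Disjoint M.E (@Matroid.truncate α (Matroid.freeOn (F : Set α)) (PLDTruncate.freeOn_finite' F) 3).E) :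
    haveI := PLDTruncate.freeOn_finite' F
    haveI := PLDClosure.disjointSum_finite' _ _ h
    ∀ lo hi δ Θ : ℕ, Θ ≤ lo + hi + δ → (lo = 0 ∨ lo + hi + δ ≤ Θ) →
      (∑ I ∈ (gr (M.disjointSum (Matroid.truncate (Matroid.freeOn (F : Set α)) 3) h)).powerset, (if lo ≤ ((M.disjointSum (Matroid.truncate (Matroid.freeOn (F : Set α)) 3) h).eRk (I : Set α)).toNat ∧ ((M.disjointSum (Matroid.truncate (Matroid.freeOn (F : Set α)) 3) h).eRk (I : Set α)).toNat ≤ hi ∧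
          Θ ≤ ((M.disjointSum (Matroid.truncate (Matroid.freeOn (F : Set α)) 3) h).eRk ((gr (M.disjointSum (Matroid.truncate (Matroid.freeOn (F : Set α)) 3) h) \ I : Finset α) : Set α)).toNat + ((M.disjointSum (Matroid.truncate (Matroid.freeOn (F : Set α)) 3) h).eRk (I : Set α)).toNat then
          (((M.disjointSum (Matroid.truncate (Matroid.freeOn (F : Set α)) 3) h).eRk ((gr (M.disjointSum (Matroid.truncate (Matroid.freeOn (F : Set α)) 3) h) \ I : Finset α) : Set α)).toNat).choose δ else 0)) ≤
        ∑ I ∈ (gr (M.disjointSum (Matroid.truncate (Matroid.freeOn (F : Set α)) 3) h)).powerset, (if lo + δ ≤ ((M.disjointSum (Matroid.truncate (Matroid.freeOn (F : Set α)) 3) h).eRk ((gr (M.disjointSum (Matroid.truncate (Matroid.freeOn (F : Set α)) 3) h) \ I : Finset α) : Set α)).toNat ∧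
          ((M.disjointSum (Matroid.truncate (Matroid.freeOn (F : Set α)) 3) h).eRk ((gr (M.disjointSum (Matroid.truncate (Matroid.freeOn (F : Set α)) 3) h) \ I : Finset α) : Set α)).toNat ≤ hi + δ then
          (((M.disjointSum (Matroid.truncate (Matroid.freeOn (F : Set α)) 3) h).eRk ((gr (M.disjointSum (Matroid.truncate (Matroid.freeOn (F : Set α)) 3) h) \ I : Finset α) : Set α)).toNat).choose δ else 0) := by
  haveI := PLDTruncate.freeOn_finite' F
  haveI := PLDClosure.disjointSum_finite' _ _ h
  have hU : (Matroid.truncate (Matroid.freeOn (F : Set α)) 3).eRank ≤ ((3 : ℕ) : ℕ∞) := by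
    rw [Matroid.truncate_eRank]; exact min_le_right _ _
  have hr' : M.eRank ≤ ((12 : ℕ) : ℕ∞) := by exact_mod_cast hr
  have hb : ∀ I ∈ (gr (M.disjointSum (Matroid.truncate (Matroid.freeOn (F : Set α)) 3) h)).powerset,
      ((M.disjointSum (Matroid.truncate (Matroid.freeOn (F : Set α)) 3) h).eRk (I : Set α)).toNat ≤ 15 ∧ ((M.disjointSum (Matroid.truncate (Matroid.freeOn (F : Set α)) 3) h).eRk ((gr (M.disjointSum (Matroid.truncate (Matroid.freeOn (F : Set α)) 3) h) \ I : Finset α) : Set α)).toNat ≤ 15 := by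
    intro I _
    constructor
    · rw [PLDClosure.toNat_eRk_disjointSum]
      have h1 := PLDCert.toNat_eRk_le_of_eRank_le M hr' ((I ∩ gr M : Finset α) : Set α)
      have h2 := PLDCert.toNat_eRk_le_of_eRank_le _ hU ((I ∩ gr (Matroid.truncate (Matroid.freeOn (F : Set α)) 3) : Finset α) : Set α)
      omega
    · rw [PLDClosure.toNat_eRk_disjointSum]
      have h1 := PLDCert.toNat_eRk_le_of_eRank_le M hr' (((gr (M.disjointSum (Matroid.truncate (Matroid.freeOn (F : Set α)) 3) h) \ I) ∩ gr M : Finset α) : Set α)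
      have h2 := PLDCert.toNat_eRk_le_of_eRank_le _ hU (((gr (M.disjointSum (Matroid.truncate (Matroid.freeOn (F : Set α)) 3) h) \ I) ∩ gr (Matroid.truncate (Matroid.freeOn (F : Set α)) 3) : Finset α) : Set α)
      omega
  refine PLDSymCex.pld_of_bounded (gr (M.disjointSum (Matroid.truncate (Matroid.freeOn (F : Set α)) 3) h)).powerset (fun I : Finset α => ((M.disjointSum (Matroid.truncate (Matroid.freeOn (F : Set α)) 3) h).eRk (I : Set α)).toNat)
    (fun I : Finset α => ((M.disjointSum (Matroid.truncate (Matroid.freeOn (F : Set α)) 3) h).eRk ((gr (M.disjointSum (Matroid.truncate (Matroid.freeOn (F : Set α)) 3) h) \ I : Finset α) : Set α)).toNat) 15 hb ?_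
  intro lo hi δ hlh hhR hδR
  have hL := PLDClosure.sum_powerset_disjointSum M _ h
    (fun x f => if lo ≤ x ∧ x ≤ hi ∧ (if lo = 0 then 0 else lo + hi + δ) ≤ f + x then f.choose δ else 0)
  have hR := PLDClosure.sum_powerset_disjointSum M _ h
    (fun x f => if lo + δ ≤ f ∧ f ≤ hi + δ then f.choose δ else 0)
  beta_reduce at hL hR
  rw [hL, hR]
  have h2L : ∀ x₁ f₁ : ℕ,
      ∑ I₂ ∈ (gr (Matroid.truncate (Matroid.freeOn (F : Set α)) 3)).powerset,
        (if lo ≤ x₁ + ((Matroid.truncate (Matroid.freeOn (F : Set α)) 3).eRk (I₂ : Set α)).toNat ∧ x₁ + ((Matroid.truncate (Matroid.freeOn (F : Set α)) 3).eRk (I₂ : Set α)).toNat ≤ hi ∧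
            (if lo = 0 then 0 else lo + hi + δ) ≤ f₁ + ((Matroid.truncate (Matroid.freeOn (F : Set α)) 3).eRk ((gr (Matroid.truncate (Matroid.freeOn (F : Set α)) 3) \ I₂ : Finset α) : Set α)).toNat +
              (x₁ + ((Matroid.truncate (Matroid.freeOn (F : Set α)) 3).eRk (I₂ : Set α)).toNat) then
          (f₁ + ((Matroid.truncate (Matroid.freeOn (F : Set α)) 3).eRk ((gr (Matroid.truncate (Matroid.freeOn (F : Set α)) 3) \ I₂ : Finset α) : Set α)).toNat).choose δ else 0) =
      (∑ i ∈ range 6, Nat.choose 5 i * (if lo ≤ x₁ + min i 3 ∧ x₁ + min i 3 ≤ hi ∧ (if lo = 0 then 0 else lo + hi + δ) ≤ (f₁ + min (5 - i) 3) + (x₁ + min i 3) then (f₁ + min (5 - i) 3).choose δ else 0)) := by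
    intro x₁ f₁
    have := PLDTruncate.sum_powerset_truncate_freeOn F 3
      (fun x₂ f₂ => if lo ≤ x₁ + x₂ ∧ x₁ + x₂ ≤ hi ∧ (if lo = 0 then 0 else lo + hi + δ) ≤ f₁ + f₂ + (x₁ + x₂) then
        (f₁ + f₂).choose δ else 0)
    beta_reduce at this
    rw [hF] at this
    exact this
  have h2R : ∀ f₁ : ℕ,
      ∑ I₂ ∈ (gr (Matroid.truncate (Matroid.freeOn (F : Set α)) 3)).powerset,
        (if lo + δ ≤ f₁ + ((Matroid.truncate (Matroid.freeOn (F : Set α)) 3).eRk ((gr (Matroid.truncate (Matroid.freeOn (F : Set α)) 3) \ I₂ : Finset α) : Set α)).toNat ∧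
            f₁ + ((Matroid.truncate (Matroid.freeOn (F : Set α)) 3).eRk ((gr (Matroid.truncate (Matroid.freeOn (F : Set α)) 3) \ I₂ : Finset α) : Set α)).toNat ≤ hi + δ then
          (f₁ + ((Matroid.truncate (Matroid.freeOn (F : Set α)) 3).eRk ((gr (Matroid.truncate (Matroid.freeOn (F : Set α)) 3) \ I₂ : Finset α) : Set α)).toNat).choose δ else 0) =
      (∑ i ∈ range 6, Nat.choose 5 i * (if lo + δ ≤ f₁ + min (5 - i) 3 ∧ f₁ + min (5 - i) 3 ≤ hi + δ then (f₁ + min (5 - i) 3).choose δ else 0)) := by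
    intro f₁
    have := PLDTruncate.sum_powerset_truncate_freeOn F 3
      (fun x₂ f₂ => if lo + δ ≤ f₁ + f₂ ∧ f₁ + f₂ ≤ hi + δ then (f₁ + f₂).choose δ else 0)
    beta_reduce at this
    rw [hF] at this
    exact this
  simp only [h2L, h2R]
  rcases Nat.lt_or_ge δ 1 with hδ0 | hδ0
  · obtain ⟨hDpos, hcert⟩ := res_uniform_3_5_table_12_part0 _ rfl lo (mem_range.2 (by omega)) hi (mem_range.2 (by omega))
      δ (mem_range.2 (by omega)) hlh
    have key := PLDResCert.sum_le_of_cert_res M hRES 12 hr' _ _ _ hcert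
    rw [← Finset.mul_sum, ← Finset.mul_sum] at key
    exact Nat.le_of_mul_le_mul_left key hDpos
  rcases Nat.lt_or_ge δ 2 with hδ1 | hδ1
  · obtain ⟨hDpos, hcert⟩ := res_uniform_3_5_table_12_part1 _ rfl lo (mem_range.2 (by omega)) hi (mem_range.2 (by omega))
      δ (mem_Ico.2 ⟨by omega, by omega⟩) hlh
    have key := PLDResCert.sum_le_of_cert_res M hRES 12 hr' _ _ _ hcert
    rw [← Finset.mul_sum, ← Finset.mul_sum] at key
    exact Nat.le_of_mul_le_mul_left key hDpos
  rcases Nat.lt_or_ge δ 3 with hδ2 | hδ2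
  · obtain ⟨hDpos, hcert⟩ := res_uniform_3_5_table_12_part2 _ rfl lo (mem_range.2 (by omega)) hi (mem_range.2 (by omega))
      δ (mem_Ico.2 ⟨by omega, by omega⟩) hlh
    have key := PLDResCert.sum_le_of_cert_res M hRES 12 hr' _ _ _ hcert
    rw [← Finset.mul_sum, ← Finset.mul_sum] at key
    exact Nat.le_of_mul_le_mul_left key hDpos
  rcases Nat.lt_or_ge δ 4 with hδ3 | hδ3
  · obtain ⟨hDpos, hcert⟩ := res_uniform_3_5_table_12_part3 _ rfl lo (mem_range.2 (by omega)) hi (mem_range.2 (by omega))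
      δ (mem_Ico.2 ⟨by omega, by omega⟩) hlh
    have key := PLDResCert.sum_le_of_cert_res M hRES 12 hr' _ _ _ hcert
    rw [← Finset.mul_sum, ← Finset.mul_sum] at key
    exact Nat.le_of_mul_le_mul_left key hDpos
  rcases Nat.lt_or_ge δ 5 with hδ4 | hδ4
  · obtain ⟨hDpos, hcert⟩ := res_uniform_3_5_table_12_part4 _ rfl lo (mem_range.2 (by omega)) hi (mem_range.2 (by omega))
      δ (mem_Ico.2 ⟨by omega, by omega⟩) hlh
    have key := PLDResCert.sum_le_of_cert_res M hRES 12 hr' _ _ _ hcert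
    rw [← Finset.mul_sum, ← Finset.mul_sum] at key
    exact Nat.le_of_mul_le_mul_left key hDpos
  rcases Nat.lt_or_ge δ 6 with hδ5 | hδ5
  · obtain ⟨hDpos, hcert⟩ := res_uniform_3_5_table_12_part5 _ rfl lo (mem_range.2 (by omega)) hi (mem_range.2 (by omega))
      δ (mem_Ico.2 ⟨by omega, by omega⟩) hlh
    have key := PLDResCert.sum_le_of_cert_res M hRES 12 hr' _ _ _ hcert
    rw [← Finset.mul_sum, ← Finset.mul_sum] at key
    exact Nat.le_of_mul_le_mul_left key hDpos
  rcases Nat.lt_or_ge δ 7 with hδ6 | hδ6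
  · obtain ⟨hDpos, hcert⟩ := res_uniform_3_5_table_12_part6 _ rfl lo (mem_range.2 (by omega)) hi (mem_range.2 (by omega))
      δ (mem_Ico.2 ⟨by omega, by omega⟩) hlh
    have key := PLDResCert.sum_le_of_cert_res M hRES 12 hr' _ _ _ hcert
    rw [← Finset.mul_sum, ← Finset.mul_sum] at key
    exact Nat.le_of_mul_le_mul_left key hDpos
  rcases Nat.lt_or_ge δ 8 with hδ7 | hδ7
  · obtain ⟨hDpos, hcert⟩ := res_uniform_3_5_table_12_part7 _ rfl lo (mem_range.2 (by omega)) hi (mem_range.2 (by omega))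
      δ (mem_Ico.2 ⟨by omega, by omega⟩) hlh
    have key := PLDResCert.sum_le_of_cert_res M hRES 12 hr' _ _ _ hcert
    rw [← Finset.mul_sum, ← Finset.mul_sum] at key
    exact Nat.le_of_mul_le_mul_left key hDpos
  rcases Nat.lt_or_ge δ 9 with hδ8 | hδ8
  · obtain ⟨hDpos, hcert⟩ := res_uniform_3_5_table_12_part8 _ rfl lo (mem_range.2 (by omega)) hi (mem_range.2 (by omega))
      δ (mem_Ico.2 ⟨by omega, by omega⟩) hlh
    have key := PLDResCert.sum_le_of_cert_res M hRES 12 hr' _ _ _ hcert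
    rw [← Finset.mul_sum, ← Finset.mul_sum] at key
    exact Nat.le_of_mul_le_mul_left key hDpos
  rcases Nat.lt_or_ge δ 10 with hδ9 | hδ9
  · obtain ⟨hDpos, hcert⟩ := res_uniform_3_5_table_12_part9 _ rfl lo (mem_range.2 (by omega)) hi (mem_range.2 (by omega))
      δ (mem_Ico.2 ⟨by omega, by omega⟩) hlh
    have key := PLDResCert.sum_le_of_cert_res M hRES 12 hr' _ _ _ hcert
    rw [← Finset.mul_sum, ← Finset.mul_sum] at key
    exact Nat.le_of_mul_le_mul_left key hDpos
  rcases Nat.lt_or_ge δ 11 with hδ10 | hδ10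
  · obtain ⟨hDpos, hcert⟩ := res_uniform_3_5_table_12_part10 _ rfl lo (mem_range.2 (by omega)) hi (mem_range.2 (by omega))
      δ (mem_Ico.2 ⟨by omega, by omega⟩) hlh
    have key := PLDResCert.sum_le_of_cert_res M hRES 12 hr' _ _ _ hcert
    rw [← Finset.mul_sum, ← Finset.mul_sum] at key
    exact Nat.le_of_mul_le_mul_left key hDpos
  rcases Nat.lt_or_ge δ 12 with hδ11 | hδ11
  · obtain ⟨hDpos, hcert⟩ := res_uniform_3_5_table_12_part11 _ rfl lo (mem_range.2 (by omega)) hi (mem_range.2 (by omega))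
      δ (mem_Ico.2 ⟨by omega, by omega⟩) hlh
    have key := PLDResCert.sum_le_of_cert_res M hRES 12 hr' _ _ _ hcert
    rw [← Finset.mul_sum, ← Finset.mul_sum] at key
    exact Nat.le_of_mul_le_mul_left key hDpos
  rcases Nat.lt_or_ge δ 13 with hδ12 | hδ12
  · obtain ⟨hDpos, hcert⟩ := res_uniform_3_5_table_12_part12 _ rfl lo (mem_range.2 (by omega)) hi (mem_range.2 (by omega))
      δ (mem_Ico.2 ⟨by omega, by omega⟩) hlh
    have key := PLDResCert.sum_le_of_cert_res M hRES 12 hr' _ _ _ hcert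
    rw [← Finset.mul_sum, ← Finset.mul_sum] at key
    exact Nat.le_of_mul_le_mul_left key hDpos
  rcases Nat.lt_or_ge δ 14 with hδ13 | hδ13
  · obtain ⟨hDpos, hcert⟩ := res_uniform_3_5_table_12_part13 _ rfl lo (mem_range.2 (by omega)) hi (mem_range.2 (by omega))
      δ (mem_Ico.2 ⟨by omega, by omega⟩) hlh
    have key := PLDResCert.sum_le_of_cert_res M hRES 12 hr' _ _ _ hcert
    rw [← Finset.mul_sum, ← Finset.mul_sum] at key
    exact Nat.le_of_mul_le_mul_left key hDpos
  rcases Nat.lt_or_ge δ 15 with hδ14 | hδ14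
  · obtain ⟨hDpos, hcert⟩ := res_uniform_3_5_table_12_part14 _ rfl lo (mem_range.2 (by omega)) hi (mem_range.2 (by omega))
      δ (mem_Ico.2 ⟨by omega, by omega⟩) hlh
    have key := PLDResCert.sum_le_of_cert_res M hRES 12 hr' _ _ _ hcert
    rw [← Finset.mul_sum, ← Finset.mul_sum] at key
    exact Nat.le_of_mul_le_mul_left key hDpos
  obtain ⟨hDpos, hcert⟩ := res_uniform_3_5_table_12_part15 _ rfl lo (mem_range.2 (by omega)) hi (mem_range.2 (by omega))
    δ (mem_Ico.2 ⟨by omega, by omega⟩) hlh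
  have key := PLDResCert.sum_le_of_cert_res M hRES 12 hr' _ _ _ hcert
  rw [← Finset.mul_sum, ← Finset.mul_sum] at key
  exact Nat.le_of_mul_le_mul_left key hDpos

end PLDResLift

end PercRepro
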